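import Mathlib
import HarnessLib
import Literature.MathematicalPhysics.QuantumLattice.KohnLuttinger
import Literature.MathematicalPhysics.QuantumLattice.KohnLuttingerLindhardMeasurable
import Literature.MathematicalPhysics.QuantumLattice.KohnLuttingerChannelStates
import Summits.HubbardSuperconductivity.HubbardSuperconductivity.Theorems.ChiralWindowCwKLChiralWindowD4Invariant
import Summits.HubbardSuperconductivity.HubbardSuperconductivity.Theorems.WeakCouplingBCSWcbcsKohnLuttingerB1gReduction

/-!
# `stub_klLindhardD4`: `D₄`-invariance of the Lindhard function of the square lattice

For the nearest-neighbour band `ε₀ = squareDispersion 1 0` and every `μ`, the static Lindhard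
function `χ₀(q) = (2π)⁻² ∫_{BZ} L(q, p) dp` satisfies `χ₀(γ q) = χ₀(q)` for all `γ ∈ D₄`
(`d4Momentum`).  Proof: the generators `T ∈ {rot, refl}` of `D₄` are linear isometries of
momentum space with `ε₀ ∘ T = ε₀`, hence `L(T q, T p) = L(q, p)` pointwise; `T` preserves Lebesgue
measure (`LinearIsometryEquiv.measurePreserving`), so
`∫_{BZ} L(Tq, p) dp = ∫_{T⁻¹ BZ} L(Tq, Tp) dp = ∫_{T⁻¹ BZ} L(q, p) dp`, and the half-open zone
`BZ = [-π,π)²` differs from `T⁻¹ BZ = [-π,π) × (-π,π]` by a Lebesgue-null set.  Iterate over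
`d4Momentum (r i) = rotⁱ`, `d4Momentum (sr i) = refl ∘ rotⁱ`.
-/

noncomputable section

set_option linter.dupNamespace false

namespace Summit.HubbardSuperconductivity.HubbardSuperconductivity.Theorems

open MeasureTheory Literature.MathematicalPhysics.QuantumLattice

/-! ### Linearity of the generators -/

/-- `rot` is additive. [folklore] -/
theorem kl_ld4_rot_add (p q : Momentum) : rotMomentum (p + q) = rotMomentum p + rotMomentum q := by
  ext i
  fin_cases i <;> simp [add_comm]

/-- `rot` is homogeneous. [folklore] -/
theorem kl_ld4_rot_smul (c : ℝ) (p : Momentum) : rotMomentum (c • p) = c • rotMomentum p := by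
  ext i
  fin_cases i <;> simp

/-- `refl` is additive. [folklore] -/
theorem kl_ld4_refl_add (p q : Momentum) :
    reflMomentum (p + q) = reflMomentum p + reflMomentum q := by
  ext i
  fin_cases i <;> simp [add_comm]

/-- `refl` is homogeneous. [folklore] -/
theorem kl_ld4_refl_smul (c : ℝ) (p : Momentum) : reflMomentum (c • p) = c • reflMomentum p := by
  ext i
  fin_cases i <;> simp

/-- `rot 0 = 0`. [folklore] -/
theorem kl_ld4_rot_zero : rotMomentum 0 = 0 := by
  ext i
  fin_cases i <;> simp

/-- `refl 0 = 0`. [folklore] -/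
theorem kl_ld4_refl_zero : reflMomentum 0 = 0 := by
  ext i
  fin_cases i <;> simp

/-! ### The generators preserve Lebesgue measure -/

/-- `rot` is a volume-preserving measurable embedding of momentum space (it is a linear isometric
automorphism of the Euclidean plane). [folklore] -/
theorem kl_ld4_rot_measurePreserving :
    MeasurePreserving rotMomentum (volume : Measure Momentum) volume ∧
      MeasurableEmbedding rotMomentum := by
  let L : Momentum ≃ₗᵢ[ℝ] Momentum :=
    { toFun := rotMomentum
      invFun := fun k => rotMomentum (rotMomentum (rotMomentum k))
      map_add' := kl_ld4_rot_add
      map_smul' := kl_ld4_rot_smul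
      left_inv := fun k => kl_d4_rot_rot_rot_rot k
      right_inv := fun k => kl_d4_rot_rot_rot_rot k
      norm_map' := kl_d4_rot_isometry.norm_map_of_map_zero kl_ld4_rot_zero }
  exact ⟨L.measurePreserving, L.toMeasurableEquiv.measurableEmbedding⟩

/-- `refl` is a volume-preserving measurable embedding of momentum space. [folklore] -/
theorem kl_ld4_refl_measurePreserving :
    MeasurePreserving reflMomentum (volume : Measure Momentum) volume ∧
      MeasurableEmbedding reflMomentum := by
  let L : Momentum ≃ₗᵢ[ℝ] Momentum :=
    { toFun := reflMomentum
      invFun := reflMomentum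
      map_add' := kl_ld4_refl_add
      map_smul' := kl_ld4_refl_smul
      left_inv := fun k => kl_d4_refl_refl k
      right_inv := fun k => kl_d4_refl_refl k
      norm_map' := kl_d4_refl_isometry.norm_map_of_map_zero kl_ld4_refl_zero }
  exact ⟨L.measurePreserving, L.toMeasurableEquiv.measurableEmbedding⟩

/-! ### The half-open zone is invariant up to a null set -/

/-- The square `[-π,π) × (-π,π]` agrees with the Brillouin zone `[-π,π)²` up to a Lebesgue-null set
(coordinate lines are null). [folklore] -/
theorem kl_ld4_square_ae_eq_brillouinZone :
    {k : Momentum | k 0 ∈ Set.Ico (-Real.pi) Real.pi ∧ k 1 ∈ Set.Ioc (-Real.pi) Real.pi}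
      =ᵐ[volume] brillouinZone := by
  have h1 : {k : Momentum | k 0 ∈ Set.Ico (-Real.pi) Real.pi ∧ k 1 ∈ Set.Ioc (-Real.pi) Real.pi} =
      (fun k : Momentum => ((k 0, k 1) : ℝ × ℝ)) ⁻¹'
        (Set.Ico (-Real.pi) Real.pi ×ˢ Set.Ioc (-Real.pi) Real.pi) := by
    ext k
    simp
  have h2 : brillouinZone = (fun k : Momentum => ((k 0, k 1) : ℝ × ℝ)) ⁻¹'
        (Set.Ico (-Real.pi) Real.pi ×ˢ Set.Ico (-Real.pi) Real.pi) := by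
    ext k
    simp [brillouinZone, Fin.forall_fin_two]
  rw [h1, h2]
  refine measurePreserving_momentum_prod.quasiMeasurePreserving.preimage_ae_eq ?_
  rw [show (volume : Measure (ℝ × ℝ)) = (volume : Measure ℝ).prod volume from rfl]
  exact Measure.set_prod_ae_eq Filter.EventuallyEq.rfl Ico_ae_eq_Ioc.symm

/-- `rot⁻¹ BZ = [-π,π) × (-π,π]`. [folklore] -/
theorem kl_ld4_rot_preimage_brillouinZone :
    rotMomentum ⁻¹' brillouinZone =
      {k : Momentum | k 0 ∈ Set.Ico (-Real.pi) Real.pi ∧ k 1 ∈ Set.Ioc (-Real.pi) Real.pi} := by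
  ext k
  simp only [Set.mem_preimage, brillouinZone, Set.mem_setOf_eq, Fin.forall_fin_two,
    kl_d4_rot_apply_zero, kl_d4_rot_apply_one, Set.mem_Ico, Set.mem_Ioc]
  constructor
  · rintro ⟨⟨h1, h2⟩, h3, h4⟩
    exact ⟨⟨h3, h4⟩, by linarith, by linarith⟩
  · rintro ⟨⟨h1, h2⟩, h3, h4⟩
    exact ⟨⟨by linarith, by linarith⟩, h1, h2⟩

/-- `refl⁻¹ BZ = [-π,π) × (-π,π]`. [folklore] -/
theorem kl_ld4_refl_preimage_brillouinZone :
    reflMomentum ⁻¹' brillouinZone =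
      {k : Momentum | k 0 ∈ Set.Ico (-Real.pi) Real.pi ∧ k 1 ∈ Set.Ioc (-Real.pi) Real.pi} := by
  ext k
  simp only [Set.mem_preimage, brillouinZone, Set.mem_setOf_eq, Fin.forall_fin_two,
    kl_d4_refl_apply_zero, kl_d4_refl_apply_one, Set.mem_Ico, Set.mem_Ioc]
  constructor
  · rintro ⟨⟨h1, h2⟩, h3, h4⟩
    exact ⟨⟨h1, h2⟩, by linarith, by linarith⟩
  · rintro ⟨⟨h1, h2⟩, h3, h4⟩
    exact ⟨⟨h1, h2⟩, by linarith, by linarith⟩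

/-- `rot⁻¹ BZ = BZ` a.e. [folklore] -/
theorem kl_ld4_rot_preimage_ae_eq :
    rotMomentum ⁻¹' brillouinZone =ᵐ[(volume : Measure Momentum)] brillouinZone := by
  rw [kl_ld4_rot_preimage_brillouinZone]
  exact kl_ld4_square_ae_eq_brillouinZone

/-- `refl⁻¹ BZ = BZ` a.e. [folklore] -/
theorem kl_ld4_refl_preimage_ae_eq :
    reflMomentum ⁻¹' brillouinZone =ᵐ[(volume : Measure Momentum)] brillouinZone := by
  rw [kl_ld4_refl_preimage_brillouinZone]
  exact kl_ld4_square_ae_eq_brillouinZone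

/-! ### Invariance of the Lindhard function under a symmetry of the band -/

/-- **Change of variables.** If `T` is an additive, volume-preserving measurable embedding of
momentum space with `T⁻¹ BZ = BZ` a.e. and `ε₀ ∘ T = ε₀`, then `χ₀ (T q) = χ₀ q`: the Lindhard
integrand satisfies `L(Tq, Tp) = L(q, p)` pointwise, and
`∫_{BZ} L(Tq, ·) = ∫_{T⁻¹BZ} L(Tq, T ·) = ∫_{T⁻¹BZ} L(q, ·) = ∫_{BZ} L(q, ·)` (no integrability
needed). [folklore] -/
theorem kl_ld4_lindhard_comp {T : Momentum → Momentum}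
    (hT : MeasurePreserving T (volume : Measure Momentum) volume) (hTe : MeasurableEmbedding T)
    (hBZ : T ⁻¹' brillouinZone =ᵐ[(volume : Measure Momentum)] brillouinZone)
    (hadd : ∀ p q, T (p + q) = T p + T q)
    (heps : ∀ k, squareDispersion 1 0 (T k) = squareDispersion 1 0 k) (μ : ℝ) (q : Momentum) :
    lindhardFunction (squareDispersion 1 0) μ (T q) = lindhardFunction (squareDispersion 1 0) μ q := by
  have hpt : ∀ p, lindhardIntegrand (squareDispersion 1 0) μ (T q) (T p) =
      lindhardIntegrand (squareDispersion 1 0) μ q p := by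
    intro p
    simp only [lindhardIntegrand, fermiOccupation, ← hadd, heps]
  unfold lindhardFunction
  congr 1
  calc ∫ p in brillouinZone, lindhardIntegrand (squareDispersion 1 0) μ (T q) p
      = ∫ p in T ⁻¹' brillouinZone, lindhardIntegrand (squareDispersion 1 0) μ (T q) (T p) :=
        (hT.setIntegral_preimage_emb hTe _ _).symm
    _ = ∫ p in T ⁻¹' brillouinZone, lindhardIntegrand (squareDispersion 1 0) μ q p := by
        simp only [hpt]
    _ = ∫ p in brillouinZone, lindhardIntegrand (squareDispersion 1 0) μ q p :=
        setIntegral_congr_set hBZ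

/-- `χ₀ ∘ rot = χ₀`. [folklore] -/
theorem kl_ld4_lindhard_rot (μ : ℝ) (q : Momentum) :
    lindhardFunction (squareDispersion 1 0) μ (rotMomentum q) =
      lindhardFunction (squareDispersion 1 0) μ q :=
  kl_ld4_lindhard_comp kl_ld4_rot_measurePreserving.1 kl_ld4_rot_measurePreserving.2
    kl_ld4_rot_preimage_ae_eq kl_ld4_rot_add kl_d4_eps_rot μ q

/-- `χ₀ ∘ refl = χ₀`. [folklore] -/
theorem kl_ld4_lindhard_refl (μ : ℝ) (q : Momentum) :
    lindhardFunction (squareDispersion 1 0) μ (reflMomentum q) =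
      lindhardFunction (squareDispersion 1 0) μ q :=
  kl_ld4_lindhard_comp kl_ld4_refl_measurePreserving.1 kl_ld4_refl_measurePreserving.2
    kl_ld4_refl_preimage_ae_eq kl_ld4_refl_add kl_d4_eps_refl μ q

/-- `χ₀ ∘ rotⁿ = χ₀`. [folklore] -/
theorem kl_ld4_lindhard_rot_iterate (μ : ℝ) (n : ℕ) (q : Momentum) :
    lindhardFunction (squareDispersion 1 0) μ (rotMomentum^[n] q) =
      lindhardFunction (squareDispersion 1 0) μ q := by
  induction n generalizing q with
  | zero => rfl
  | succ n ih => rw [Function.iterate_succ_apply', kl_ld4_lindhard_rot, ih]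

/-! ### The stub -/

/-- **`D₄`-invariance of the Lindhard function** of `ε₀ = squareDispersion 1 0`:
`χ₀(γ q) = χ₀(q)` for every `γ ∈ D₄` (the band and the Brillouin-zone integral are `D₄`-invariant; the
half-open zone differs from its image by a null set). [folklore] -/
theorem stub_klLindhardD4 : ∀ (μ : ℝ) (g : DihedralGroup 4) (q : Momentum),
    lindhardFunction (squareDispersion 1 0) μ (d4Momentum g q) = lindhardFunction (squareDispersion 1 0) μ q := by
  intro μ g q
  cases g with
  | r i => exact kl_ld4_lindhard_rot_iterate μ i.val q
  | sr i =>
    show lindhardFunction (squareDispersion 1 0) μ (reflMomentum (rotMomentum^[i.val] q)) = _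
    rw [kl_ld4_lindhard_refl, kl_ld4_lindhard_rot_iterate]

end Summit.HubbardSuperconductivity.HubbardSuperconductivity.Theorems

end
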